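import Literature.Analysis.Convexity.AnisotropicPerimeterSeparated
import Literature.Analysis.Convexity.AnisotropicPerimeterComplement
import HarnessLib

/-!
# The anisotropic perimeter of a set with a compactly contained hole

Topic `Literature/Analysis/Convexity`; namespace `Literature.Analysis.Convexity`. Companion of
`AnisotropicPerimeterComplement.lean` (complement rule `P_K(ℝⁿ \ A) = P_{-K}(A)`, Maggi's Exercise
12.9) and `AnisotropicPerimeterSeparated.lean` (additivity `P_K(A ∪ B) = P_K(A) + P_K(B)` over sets
with disjoint closures, the separated case of Maggi's Theorem 16.3 (16.12)).

For a CONVEX constraint body `K ∋ 0`, a measurable set `A ⊆ ℝⁿ` and a measurable `G` whose closure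
lies in the interior of `A` (a "hole" punched well inside `A`):

  `P_K(A \ G) = P_K(A) + P_{-K}(G)`,

i.e. the boundary of the hole is counted with the REVERSED outer normal (body `-K`); for an
origin-symmetric body, `P_K(A \ G) = P_K(A) + P_K(G)`, in particular `Per(A \ G) = Per(A) + Per(G)`.
Proof (bookkeeping only, no structure theory): `A \ G = (Aᶜ ∪ G)ᶜ`, the complement rule turns the
body into `-K`, and `Aᶜ`, `G` have disjoint closures (`closure Aᶜ = (interior A)ᶜ`), so the `-K`
perimeter is additive over `Aᶜ ∪ G`; the complement rule once more gives `P_{-K}(Aᶜ) = P_K(A)`.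
Printed road: Maggi's Theorem 16.3 (16.12) with `E = Aᶜ`, `F = G` (the term
`H^{n-1}({ν_E = ν_F})` is empty for separated sets) combined with (12.4).  In the vocabulary of the
venture `Summits/Ventures/Crystal3D` (crux `PolycrystalWulffBound`) this is the rule
`ι_K(G, A \ G) = (P_K(G) + P_{-K}(G))/2` for a grain `G` inside a container `A`: the whole boundary
of `G` is interface with `A \ G` — the bookkeeping behind "exterior facets = interface with the
complement cells of a bounding box".

## References
* F. Maggi, *Sets of Finite Perimeter and Geometric Variational Problems*, CUP 2012: Exercise 12.9
  (12.4) p. 123 (complement), Exercise 12.16 p. 125 (locality), Theorem 16.3 (16.12) p. 178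
  (union of sets of finite perimeter), (20.2) p. 258 (anisotropic surface energies). [`Maggi2012`]

## Contents (all PROVED; no definitions, no named facts)
* `diff_eq_compl_compl_union` — `A \ G = (Aᶜ ∪ G)ᶜ` (plumbing);
* `disjoint_closure_compl_closure_of_subset_interior` — `closure G ⊆ interior A ⇒
  Disjoint (closure Aᶜ) (closure G)` (plumbing);
* `anisotropicPerimeter_diff_eq_add_neg` — `P_K(A \ G) = P_K(A) + P_{-K}(G)`;
* `anisotropicPerimeter_diff_eq_add_of_neg_eq` — symmetric body: `P_K(A \ G) = P_K(A) + P_K(G)`;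
* `perimeter_diff_eq_add` — `Per(A \ G) = Per(A) + Per(G)`;
* `anisotropicPerimeter_add_diff_sub_eq` — the interface form
  `P_K(G) + P_K(A \ G) - P_K(A) = P_K(G) + P_{-K}(G)` (in `ℝ≥0∞`, for `P_K(A) < ∞`).
-/

noncomputable section

open Set Filter Function Metric
open _root_.MeasureTheory
open scoped ENNReal Topology Pointwise

namespace Literature.Analysis.Convexity

open Literature.MathematicalPhysics.StatisticalMechanics (fieldDivergence perimeter)

section Plumbing

variable {α : Type*}

/-- `A \ G = (Aᶜ ∪ G)ᶜ`. [cite: Maggi2012, Exercise 12.9 p. 123 — plumbing] -/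
theorem diff_eq_compl_compl_union (A G : Set α) : A \ G = (Aᶜ ∪ G)ᶜ := by
  rw [compl_union, compl_compl, sdiff_eq]

variable {V : Type*} [TopologicalSpace V]

/-- If `closure G ⊆ interior A` then `Aᶜ` and `G` have disjoint closures
(`closure Aᶜ = (interior A)ᶜ`). [cite: Maggi2012, Exercise 12.16 p. 125 — plumbing] -/
theorem disjoint_closure_compl_closure_of_subset_interior {A G : Set V}
    (h : closure G ⊆ interior A) : Disjoint (closure Aᶜ) (closure G) := by
  rw [closure_compl, Set.disjoint_left]
  intro x hx hxG
  exact hx (h hxG)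

end Plumbing

section Euclidean

variable {n : ℕ}

/-- **Hole rule: `P_K(A \ G) = P_K(A) + P_{-K}(G)`** for a convex body `K ∋ 0`, measurable `A, G`
with `closure G ⊆ interior A` (the boundary of the hole carries the reversed normal).
[cite: Maggi2012, Theorem 16.3 (16.12) p. 178 with Exercise 12.9 (12.4) p. 123; (20.2) p. 258] -/
theorem anisotropicPerimeter_diff_eq_add_neg {K : Set (EuclideanSpace ℝ (Fin n))}
    (hKc : Convex ℝ K) (h0K : (0 : EuclideanSpace ℝ (Fin n)) ∈ K)
    {A G : Set (EuclideanSpace ℝ (Fin n))} (hA : MeasurableSet A) (hG : MeasurableSet G)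
    (hGA : closure G ⊆ interior A) :
    anisotropicPerimeter K (A \ G) = anisotropicPerimeter K A + anisotropicPerimeter (-K) G := by
  have hKc' : Convex ℝ (-K) := hKc.neg
  have h0K' : (0 : EuclideanSpace ℝ (Fin n)) ∈ -K := by simpa using h0K
  rw [diff_eq_compl_compl_union, anisotropicPerimeter_compl K (hA.compl.union hG),
    anisotropicPerimeter_union_of_disjoint_closure hKc' h0K' hA.compl hG
      (disjoint_closure_compl_closure_of_subset_interior hGA),
    anisotropicPerimeter_compl (-K) hA, neg_neg]

/-- **Hole rule for an origin-symmetric body:** `-K = K ⇒ P_K(A \ G) = P_K(A) + P_K(G)` for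
measurable `A, G` with `closure G ⊆ interior A`.
[cite: Maggi2012, Theorem 16.3 (16.12) p. 178 with Exercise 12.9 (12.4) p. 123] -/
theorem anisotropicPerimeter_diff_eq_add_of_neg_eq {K : Set (EuclideanSpace ℝ (Fin n))}
    (hKc : Convex ℝ K) (h0K : (0 : EuclideanSpace ℝ (Fin n)) ∈ K) (hK : -K = K)
    {A G : Set (EuclideanSpace ℝ (Fin n))} (hA : MeasurableSet A) (hG : MeasurableSet G)
    (hGA : closure G ⊆ interior A) :
    anisotropicPerimeter K (A \ G) = anisotropicPerimeter K A + anisotropicPerimeter K G := by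
  rw [anisotropicPerimeter_diff_eq_add_neg hKc h0K hA hG hGA, hK]

/-- **`Per(A \ G) = Per(A) + Per(G)`** for De Giorgi's perimeter, measurable `A, G` with
`closure G ⊆ interior A`. [cite: Maggi2012, Theorem 16.3 (16.12) p. 178 with (12.4) p. 123] -/
theorem perimeter_diff_eq_add {A G : Set (EuclideanSpace ℝ (Fin n))} (hA : MeasurableSet A)
    (hG : MeasurableSet G) (hGA : closure G ⊆ interior A) :
    perimeter (A \ G) = perimeter A + perimeter G := by
  rw [perimeter_eq_anisotropicPerimeter_closedBall, perimeter_eq_anisotropicPerimeter_closedBall,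
    perimeter_eq_anisotropicPerimeter_closedBall]
  refine anisotropicPerimeter_diff_eq_add_of_neg_eq (convex_closedBall 0 1)
    (mem_closedBall_self zero_le_one) ?_ hA hG hGA
  rw [neg_closedBall, neg_zero]

/-- **Interface form of the hole rule:** for a convex body `K ∋ 0`, measurable `A, G` with
`closure G ⊆ interior A` and `P_K(A) < ∞`,
`P_K(G) + P_K(A \ G) - P_K(A) = P_K(G) + P_{-K}(G)` — twice the `K`-interface of the hole `G` with
the rest `A \ G` of its container is the two-sided energy of the whole boundary of `G`.
[cite: Maggi2012, Theorem 16.3 (16.12) p. 178 with Exercise 12.9 (12.4) p. 123; (20.2) p. 258] -/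
theorem anisotropicPerimeter_add_diff_sub_eq {K : Set (EuclideanSpace ℝ (Fin n))}
    (hKc : Convex ℝ K) (h0K : (0 : EuclideanSpace ℝ (Fin n)) ∈ K)
    {A G : Set (EuclideanSpace ℝ (Fin n))} (hA : MeasurableSet A) (hG : MeasurableSet G)
    (hGA : closure G ⊆ interior A) (hfin : anisotropicPerimeter K A ≠ ∞) :
    anisotropicPerimeter K G + anisotropicPerimeter K (A \ G) - anisotropicPerimeter K A =
      anisotropicPerimeter K G + anisotropicPerimeter (-K) G := by
  rw [anisotropicPerimeter_diff_eq_add_neg hKc h0K hA hG hGA,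
    show anisotropicPerimeter K G + (anisotropicPerimeter K A + anisotropicPerimeter (-K) G) =
      anisotropicPerimeter K G + anisotropicPerimeter (-K) G + anisotropicPerimeter K A by ring,
    ENNReal.add_sub_cancel_right hfin]

end Euclidean

end Literature.Analysis.Convexity

end
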